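import Literature.Geometry.Lorentzian.ObstructionFreeGluing
import Literature.Geometry.Lorentzian.ExactKerrEnd
import HarnessLib

/-!
# Gluing up to linear obstructions at unit scale (Mao–Oh–Tao 2023, Thm 1.3, exterior case)

Y. Mao, S.-J. Oh, Z. Tao, *Initial data gluing in the asymptotically flat regime via solution operators with prescribed
support properties*, arXiv:2308.13031 [MaoOhTao2023], **Theorem 1.3** (p. 5, "Gluing up to linear obstructions at unit
scale"), EXTERIOR case, with its two printed riders (Lipschitz continuity of `(g̊, k̊) ↦ (g, k, Q)`; persistence of
regularity) and **Definition 1.2** (`𝒬`-admissible annular families).  Companion of `ObstructionFreeGluing.lean`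
(Thm 1.7), whose vocabulary (`IsBump`, `avgE/avgP/avgC/avgJ`, `DevLE`, `InitialDataSet.VacOn/SameAt`) is reused; this is
the first of the two printed atoms of MOT's proof of their Thm 1.6 (= Corvino–Schoen 2006 Thm 4 / Chruściel–Delay 2003
Thm 8.1, parity-free), the second being the exterior Kerr family of Lemma 4.2 (`ExteriorKerrFamily.lean`).  Requested by
route `ExactKerrEnds` of the final-state summit (crux `TameEscapeToKerrEnds`, line `matched-kerr-solution-map`, `wi-38973`).

## The printed statement (pp. 4–5)

Notation (p. 4): `B_r` the ball of radius `r` about `0`, `A_r = B_{2r} ∖ B̄_r`, `Ã_r = B_{4r} ∖ B̄_{r/2}`; `H^s(Ω)` the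
extendible Sobolev space; `Q[(g,k); A_r] ∈ ℝ¹⁰` the `η`-averaged charges `(E, P₁, P₂, P₃, C₁, C₂, C₃, J₁, J₂, J₃)` (1.7).

**Definition 1.2.** "Let a bounded open subset `𝒬 ⊆ ℝ¹⁰` and `s ∈ ℝ` be given.  We say that a 10-parameter family
`{(g_Q, k_Q)}_𝒬` is a `𝒬`-admissible family of annular initial data sets on `Ã_r` with Sobolev regularity `s` if: for each
`Q ∈ 𝒬`, `(g_Q, k_Q) ∈ (H¹ ∩ C⁰) × L²(Ã_r)` and solves (1.1) in `Ã_r`; for each `Q ∈ 𝒬`, `(g_Q, k_Q) ∈ H^s × H^{s−1}(Ã_r)`;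
the map `𝒬 → H^s × H^{s−1}(Ã_r)`, `Q ↦ (g_Q, k_Q)` is Lipschitz; for each `Q ∈ 𝒬 ⊆ ℝ¹⁰`, we have `Q = Q[(g_Q, k_Q); A_r]`."

**Theorem 1.3.** "For each `s > 3/2`, there exist `ε_c = ε_c(s) > 0` and `M_c = M_c(s) > 0` such that the following holds.
Let `(g̊, k̊)` be a solution to (1.1) in `H^s × H^{s−1}(Ã₁)` such that (1.9) `‖(g̊ − δ, k̊)‖_{H^s×H^{s−1}(Ã₁)} ≤ ε`.  Define
`Q̊ = Q[(g̊, k̊); A₁]`.  Let `𝒬 ⊆ ℝ¹⁰` be a bounded open set such that (1.10) `Q̊ ∈ 𝒬`, `B_{M_c ε²}(Q̊) ⊆ 𝒬`, and consider a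
`𝒬`-admissible family … on `Ã₁` with Sobolev regularity `s` such that, for all `Q, Q' ∈ 𝒬`, (1.11)
`‖(g_Q − δ, k_Q)‖ ≤ ε`, (1.12) `‖(g_Q − g_{Q'}, k_Q − k_{Q'})‖ ≤ K|Q − Q'|` (norms of `H^s × H^{s−1}(Ã₁)`).  Then:
*Exterior gluing.* If `ε < ε_c` and `Kε < ε_c`, then there exists `(g, k) ∈ H^s × H^{s−1}(Ã₁)` and `Q ∈ 𝒬` such that
`‖(g − δ, k)‖_{H^s×H^{s−1}(Ã₁)} ≲ ε`, `|Q − Q̊| ≤ M_c ε²`, and `(g, k) = (g̊, k̊)` in `A_{1/2}`, `= (g_Q, k_Q)` in `A₂`.  …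
*(Lipschitz continuity)* The map `(g̊, k̊) ↦ (g, k, Q)` is Lipschitz as a map from the subset of `H^s × H^{s−1}` restricted
by (1.9)–(1.10) into `H^s × H^{s−1} × ℝ¹⁰`.  *(Persistence of regularity)* If `(g̊, k̊) ∈ H^{s+m} × H^{s+m−1}(Ã₁)` and the
family is of Sobolev regularity `s + m` for `m ∈ ℕ`, then `(g, k) ∈ H^{s+m} × H^{s+m−1}(Ã₁)` and [bound]."  (Proof §3,
pp. 12–14; p. 14: "a single choice of `ε_c` works for all `m`".)

## This rendering (`s = 2`; smooth data; constants existential)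

As in `ObstructionFreeGluing.lean`: all data are smooth `InitialDataSet (𝓡 3) E3` on `ℝ³` of which only restrictions to
the relevant annuli enter; the SMALLNESS hypotheses (1.9), (1.11), (1.12) are imposed in the `C² × C¹` sup form (`DevLE`,
`DiffDevLE`) on the closed annulus `{1/2 ≤ |x| ≤ 4}`, which dominates the `H² × H¹(Ã₁)` norms up to a fixed constant
(absorbed in the existential `ε_c, M_c, C_c`); the family is assumed of Sobolev regularity `2 + m` for EVERY `m` in the
sup form (`∀ m ∃ K_m`, Lipschitz in `C^m(Ã₁)`), so that by persistence of regularity for all `m` (same `ε_c`) the glued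
pair is smooth on `Ã₁`, and — extended by `(g̊, k̊)` inside `B₁` and by `(g_Q, k_Q)` outside `B₂` (they agree on the open
annuli `A_{1/2}`, `A₂`) — is ONE smooth datum on `ℝ³`; the solution is packaged as a MAP `sol` (with charge map `chg`) on
data, so that the Lipschitz rider can be stated; OUTPUT sizes (the bound `≲ ε` and the Lipschitz inequality) are measured
in the intrinsic `H² × H¹` (semi)norms of the open annulus `Ã₁` (`sobolevDevSq`, `sobolevDistSq`: `Σ_{m≤2} ∫_{Ã₁} |∂^m ·|²`),
which are dominated by the printed extendible norms, the input side of the Lipschitz inequality by Stein extension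
(constant absorbed in `L`).  Interior gluing, general `s > 3/2`, and `H^s`-smallness hypotheses are not rendered.
-- TODO(general form): interior case; `s > 3/2`; hypotheses in `H^s × H^{s−1}(Ã₁)`.

## References

* [MaoOhTao2023] Y. Mao, S.-J. Oh, Z. Tao, arXiv:2308.13031, Def. 1.2, Thm. 1.3 (p. 5), Rem. 1.4, §3 (pp. 12–14).
* [CorvinoSchoen2006] J. Corvino, R. Schoen, J. Differential Geom. 73 (2006), Thm. 4.
* [ChruscielDelay2003] P. T. Chruściel, E. Delay, Mém. Soc. Math. Fr. 94 (2003), Thm. 8.1.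
-/

noncomputable section

namespace Literature.Geometry.Lorentzian

open scoped _root_.Manifold _root_.ContDiff BigOperators _root_.Topology
open _root_.MeasureTheory _root_.Filter

namespace MaoOhTao

open InitialDataSet

/-! ## §1 Vocabulary: the charge vector, pair deviations, intrinsic `H² × H¹` sizes on `Ã₁` -/

/-- The 10-vector of `η`-averaged charges `Q[(g,k); A_r] = (E, P₁, P₂, P₃, C₁, C₂, C₃, J₁, J₂, J₃)[(g,k); A_r] ∈ ℝ¹⁰`
(Euclidean). [cite: MaoOhTao2023, §1.2 (1.7)] -/
def chargeVec (η : ℝ → ℝ) (r : ℝ) (g k : E3 → E3 →L[ℝ] E3 →L[ℝ] ℝ) : EuclideanSpace ℝ (Fin 10) :=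
  !₂[avgE η r g, avgP η r k 0, avgP η r k 1, avgP η r k 2, avgC η r g 0, avgC η r g 1, avgC η r g 2,
    avgJ η r k 0, avgJ η r k 1, avgJ η r k 2]

set_option synthInstance.maxHeartbeats 120000 in
-- operator norm instance on `E3 [×m]→L[ℝ] (E3 →L[ℝ] E3 →L[ℝ] ℝ)`, as for `DevLE`
/-- **`C² × C¹` sup-size of a difference of pairs** on the closed annulus `{a ≤ |x| ≤ b}`: `|∂^m (g − g')(x)| ≤ s` for
`m ≤ 2` and `|∂^m (k − k')(x)| ≤ s` for `m ≤ 1` (it dominates `‖(g − g', k − k')‖_{H²×H¹}` on a bounded annulus;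
`DevLE g k a b s` is the case `(g', k') = (δ, 0)`). [folklore] -/
def DiffDevLE (g k g' k' : E3 → E3 →L[ℝ] E3 →L[ℝ] ℝ) (a b s : ℝ) : Prop :=
  ∀ x : E3, a ≤ ‖x‖ → ‖x‖ ≤ b →
    (∀ m : ℕ, m ≤ 2 → ‖iteratedFDeriv ℝ m (fun y ↦ g y - g' y) x‖ ≤ s) ∧
    (∀ m : ℕ, m ≤ 1 → ‖iteratedFDeriv ℝ m (fun y ↦ k y - k' y) x‖ ≤ s)

set_option synthInstance.maxHeartbeats 120000 in
-- operator norm instance, as above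
/-- **Squared intrinsic `H² × H¹` distance of two pairs on the open annulus `{a < |x| < b}`**:
`Σ_{m ≤ 2} ∫_{a<|x|<b} |∂^m (g − g')|² dx + Σ_{m ≤ 1} ∫_{a<|x|<b} |∂^m (k − k')|² dx` (dominated by the square of the
extendible `H² × H¹` norm of the difference used in the paper, p. 4). [cite: MaoOhTao2023, §1.1 (notation, p. 4)] -/
def sobolevDistSq (g k g' k' : E3 → E3 →L[ℝ] E3 →L[ℝ] ℝ) (a b : ℝ) : ℝ :=
  (∑ m ∈ Finset.range 3,
      ∫ x in {x : E3 | a < ‖x‖ ∧ ‖x‖ < b}, ‖iteratedFDeriv ℝ m (fun y ↦ g y - g' y) x‖ ^ 2) +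
    ∑ m ∈ Finset.range 2,
      ∫ x in {x : E3 | a < ‖x‖ ∧ ‖x‖ < b}, ‖iteratedFDeriv ℝ m (fun y ↦ k y - k' y) x‖ ^ 2

/-- **Squared intrinsic `H² × H¹` deviation from flat data** `(δ, 0)` on `{a < |x| < b}`. [folklore] -/
def sobolevDevSq (g k : E3 → E3 →L[ℝ] E3 →L[ℝ] ℝ) (a b : ℝ) : ℝ :=
  sobolevDistSq g k (fun _ ↦ (innerSL ℝ : E3 →L[ℝ] E3 →L[ℝ] ℝ)) (fun _ ↦ 0) a b

set_option synthInstance.maxHeartbeats 120000 in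
-- operator norm instance, as above
/-- **A smooth `𝒬`-admissible family of annular data on `Ã₁` of size `ε` and Lipschitz constant `K`** (MOT Def. 1.2
with (1.11)–(1.12) of Thm 1.3, for `s = 2` AND of Sobolev regularity `2 + m` for every `m`, sup form): the members
`F Q`, `Q ∈ 𝒬`, solve the vacuum constraints on `Ã₁ = {1/2 < |x| < 4}`; their `η`-averaged charges on `A₁` are `Q`;
`‖(g_Q − δ, k_Q)‖ ≤ ε` and `‖(g_Q − g_{Q'}, k_Q − k_{Q'})‖ ≤ K |Q − Q'|` in the `C² × C¹` sup sense on `{1/2 ≤ |x| ≤ 4}`;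
and for every `m` the map `Q ↦ (g_Q, k_Q)` is Lipschitz into `C^m × C^m({1/2 ≤ |x| ≤ 4})` (some constant `K_m`).
[cite: MaoOhTao2023, Def. 1.2 and Thm. 1.3 (1.11)–(1.12)] -/
def IsAdmissibleFamily (η : ℝ → ℝ) (𝒬 : Set (EuclideanSpace ℝ (Fin 10)))
    (F : EuclideanSpace ℝ (Fin 10) → InitialDataSet (𝓡 3) E3) (ε K : ℝ) : Prop :=
  (∀ Q ∈ 𝒬, (F Q).VacOn (1 / 2) 4) ∧
  (∀ Q ∈ 𝒬, chargeVec η 1 (F Q).coordH (F Q).coordK = Q) ∧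
  (∀ Q ∈ 𝒬, DevLE (F Q).coordH (F Q).coordK (1 / 2) 4 ε) ∧
  (∀ Q ∈ 𝒬, ∀ Q' ∈ 𝒬, DiffDevLE (F Q).coordH (F Q).coordK (F Q').coordH (F Q').coordK (1 / 2) 4 (K * ‖Q - Q'‖)) ∧
  (∀ m : ℕ, ∃ Km : ℝ, ∀ Q ∈ 𝒬, ∀ Q' ∈ 𝒬, ∀ x : E3, 1 / 2 ≤ ‖x‖ → ‖x‖ ≤ 4 →
    ‖iteratedFDeriv ℝ m (fun y ↦ (F Q).coordH y - (F Q').coordH y) x‖ ≤ Km * ‖Q - Q'‖ ∧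
    ‖iteratedFDeriv ℝ m (fun y ↦ (F Q).coordK y - (F Q').coordK y) x‖ ≤ Km * ‖Q - Q'‖)

/-- **An admissible input for Thm 1.3** relative to `(η, 𝒬, M_c, ε)`: a datum `D₀ = (g̊, k̊)` solving the vacuum
constraints on `Ã₁`, with `‖(g̊ − δ, k̊)‖ ≤ ε` ((1.9), `C² × C¹` sup form on `{1/2 ≤ |x| ≤ 4}`) and whose charge vector
`Q̊ = Q[(g̊, k̊); A₁]` satisfies (1.10): `Q̊ ∈ 𝒬` and `B_{M_c ε²}(Q̊) ⊆ 𝒬`. [cite: MaoOhTao2023, Thm. 1.3 (1.9)–(1.10)] -/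
def IsAdmissibleInput (η : ℝ → ℝ) (𝒬 : Set (EuclideanSpace ℝ (Fin 10))) (Mc ε : ℝ)
    (D₀ : InitialDataSet (𝓡 3) E3) : Prop :=
  D₀.VacOn (1 / 2) 4 ∧ DevLE D₀.coordH D₀.coordK (1 / 2) 4 ε ∧
    chargeVec η 1 D₀.coordH D₀.coordK ∈ 𝒬 ∧
    Metric.ball (chargeVec η 1 D₀.coordH D₀.coordK) (Mc * ε ^ 2) ⊆ 𝒬

/-! ## §2 Theorem 1.3, exterior case, with the Lipschitz and regularity riders -/

/-- **Gluing up to linear obstructions at unit scale — exterior case** (Mao–Oh–Tao, arXiv:2308.13031, Thm 1.3 with its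
riders; here `s = 2`, smooth data, sup-form smallness).  For every admissible bump `η` there are `ε_c, M_c, C_c > 0` such
that: for every bounded open `𝒬 ⊆ ℝ¹⁰`, every smooth `𝒬`-admissible family `F` on `Ã₁` of size `ε` and Lipschitz
constant `K` (`IsAdmissibleFamily`), with `0 < ε < ε_c`, `0 ≤ K`, `K ε < ε_c`, there are a solution map `sol`, a charge
map `chg` and `L ≥ 0` with
* (exterior gluing) for every admissible input `D₀ = (g̊, k̊)` (`IsAdmissibleInput`: vacuum on `Ã₁`, `‖(g̊ − δ, k̊)‖ ≤ ε`,
  `Q̊ ∈ 𝒬`, `B_{M_c ε²}(Q̊) ⊆ 𝒬`): `Q := chg D₀ ∈ 𝒬`, `|Q − Q̊| ≤ M_c ε²`, and `D := sol D₀` is a smooth datum on `ℝ³`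
  solving the vacuum constraints on `Ã₁ = {1/2 < |x| < 4}` (the gluing problem of §1.3, "find an almost flat initial data
  set"; explicit in the proof, §3 p. 12: "such that `(h, π) = (h̄_Q + h̃_Q, π̄_Q + π̃_Q)` solves (3.2)–(3.3)"), equal to `D₀`
  on `{|x| < 1}` and to `F Q` on `{|x| > 2}`, with `‖(g − δ, k)‖_{H²×H¹(Ã₁)} ≤ C_c ε` (printed: `≲ ε`);
* (Lipschitz continuity) for any two admissible inputs `D₀, D₀'`:
  `‖(g − g', k − k')‖²_{H²×H¹(Ã₁)} + |Q − Q'|² ≤ L² ‖(g̊ − g̊', k̊ − k̊')‖²_{H²×H¹(Ã₁)}`.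
Persistence of regularity (p. 5; p. 14: one `ε_c` for all `m`) is built in: smooth inputs and a family of regularity
`2 + m` for all `m` give a smooth glued pair.  See the module docstring for the printed text and the domination of the
printed `H^s` norms by the sup-form hypotheses. Named fact (D-0014).
-- TODO(general form): interior gluing; `s > 3/2`; `H^s × H^{s−1}` smallness hypotheses.
[cite: MaoOhTao2023, Thm. 1.3 (p. 5) with Lipschitz continuity and persistence of regularity; Def. 1.2] -/
def GluingUpToLinearObstructionsExterior : Prop :=
  ∀ η : ℝ → ℝ, IsBump η →
    ∃ εc Mc Cc : ℝ, 0 < εc ∧ 0 < Mc ∧ 0 < Cc ∧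
      ∀ (𝒬 : Set (EuclideanSpace ℝ (Fin 10))) (F : EuclideanSpace ℝ (Fin 10) → InitialDataSet (𝓡 3) E3)
        (ε K : ℝ),
        IsOpen 𝒬 → Bornology.IsBounded 𝒬 → 0 < ε → ε < εc → 0 ≤ K → K * ε < εc →
        IsAdmissibleFamily η 𝒬 F ε K →
        ∃ (sol : InitialDataSet (𝓡 3) E3 → InitialDataSet (𝓡 3) E3)
          (chg : InitialDataSet (𝓡 3) E3 → EuclideanSpace ℝ (Fin 10)) (L : ℝ), 0 ≤ L ∧
          (∀ D₀ : InitialDataSet (𝓡 3) E3, IsAdmissibleInput η 𝒬 Mc ε D₀ →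
            chg D₀ ∈ 𝒬 ∧ ‖chg D₀ - chargeVec η 1 D₀.coordH D₀.coordK‖ ≤ Mc * ε ^ 2 ∧
            (sol D₀).VacOn (1 / 2) 4 ∧
            (∀ y : E3, ‖y‖ < 1 → (sol D₀).SameAt D₀ y) ∧
            (∀ y : E3, 2 < ‖y‖ → (sol D₀).SameAt (F (chg D₀)) y) ∧
            sobolevDevSq (sol D₀).coordH (sol D₀).coordK (1 / 2) 4 ≤ (Cc * ε) ^ 2) ∧
          (∀ D₀ D₀' : InitialDataSet (𝓡 3) E3, IsAdmissibleInput η 𝒬 Mc ε D₀ → IsAdmissibleInput η 𝒬 Mc ε D₀' →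
            sobolevDistSq (sol D₀).coordH (sol D₀).coordK (sol D₀').coordH (sol D₀').coordK (1 / 2) 4 +
                ‖chg D₀ - chg D₀'‖ ^ 2 ≤
              L ^ 2 * sobolevDistSq D₀.coordH D₀.coordK D₀'.coordH D₀'.coordK (1 / 2) 4)


/-! ## §3 Lemma 4.2: the quantitative exterior Kerr family -/

/-- The odd part `F⁻(x) = ½ (F(x) − F(−x))` of a field on `ℝ³`. [cite: MaoOhTao2023, §1.1 (notation, p. 4)] -/
def oddPart {V : Type*} [AddCommGroup V] [Module ℝ V] (F : E3 → V) (x : E3) : V := (1 / 2 : ℝ) • (F x - F (-x))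

/-- The even part `F⁺(x) = ½ (F(x) + F(−x))` of a field on `ℝ³`. [cite: MaoOhTao2023, §1.1 (notation, p. 4)] -/
def evenPart {V : Type*} [AddCommGroup V] [Module ℝ V] (F : E3 → V) (x : E3) : V := (1 / 2 : ℝ) • (F x + F (-x))

/-- `|P(Q)|`, the Euclidean length of the momentum components `(Q₁, Q₂, Q₃)` of `Q ∈ ℝ¹⁰`. [cite: MaoOhTao2023, §1.2] -/
def momNorm (Q : EuclideanSpace ℝ (Fin 10)) : ℝ := Real.sqrt (Q 1 ^ 2 + Q 2 ^ 2 + Q 3 ^ 2)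

/-- `|(C, J)(Q)|`, the Euclidean length of the components `(Q₄, …, Q₉)` of `Q ∈ ℝ¹⁰`. [cite: MaoOhTao2023, §1.2] -/
def cjNorm (Q : EuclideanSpace ℝ (Fin 10)) : ℝ :=
  Real.sqrt (Q 4 ^ 2 + Q 5 ^ 2 + Q 6 ^ 2 + Q 7 ^ 2 + Q 8 ^ 2 + Q 9 ^ 2)

/-- The mass parameter `M(Q) = sgn E √(E² − |P|²)` of a charge vector with `E(Q) > |P(Q)|` (so `sgn E = 1`).
[cite: MaoOhTao2023, Lemma 4.2] -/
def massParam (Q : EuclideanSpace ℝ (Fin 10)) : ℝ := Real.sqrt (Q 0 ^ 2 - momNorm Q ^ 2)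

/-- The Lorentz factor `γ(Q) = |E| / |M|` of a charge vector with `E(Q) > |P(Q)|`. [cite: MaoOhTao2023, Lemma 4.2] -/
def lorentzFactor (Q : EuclideanSpace ℝ (Fin 10)) : ℝ := Q 0 / massParam Q

set_option synthInstance.maxHeartbeats 120000 in
-- operator norm instance, as above
/-- **The quantitative exterior Kerr family** (Mao–Oh–Tao, arXiv:2308.13031, Lemma 4.2, p. 15; proof sketched in their
Appendix B after Chruściel–Delay 2003).  Printed: "Let `𝓔 := {Q ∈ ℝ¹⁰ : |E(Q)| > |P(Q)|}`.  For each `Q ∈ 𝓔`, there exists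
an exterior region of an initial data set for one of the Kerr spacetimes, denoted by `(g_Q^Kerr, k_Q^Kerr)`, such that
(4.3) `Q^ADM[(g_Q^Kerr, k_Q^Kerr)] = Q`, (4.4) `|x|ⁿ |∂⁽ⁿ⁾(g_Q^Kerr − δ)| + |x|ⁿ⁺¹ |∂⁽ⁿ⁾ k_Q^Kerr| ≤ C_D(n, γ) |M| |x|⁻¹`,
(4.5) `|x|ⁿ |∂⁽ⁿ⁾ g_Q^{Kerr,−}| + |x|ⁿ⁺¹ |∂⁽ⁿ⁾ k_Q^{Kerr,+}| ≤ C_D(n, γ) |M| |x|⁻²`,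
(4.6) `|x|ⁿ |∂⁽ⁿ⁾ ∂_{E,P} g_Q^Kerr| + |x|ⁿ⁺¹ |∂⁽ⁿ⁾ ∂_{E,P} k_Q^Kerr| ≤ C_D(n, γ) |x|⁻¹`,
(4.7) `|x|ⁿ |∂⁽ⁿ⁾ ∂_{E,P} g_Q^{Kerr,−}| + |x|ⁿ⁺¹ |∂⁽ⁿ⁾ ∂_{E,P} k_Q^{Kerr,+}| ≤ C_D(n, γ) (|M|⁻¹ |(C, J)| + 1) |x|⁻²`,
(4.8) `|x|ⁿ |∂⁽ⁿ⁾ ∂_{C,J} g_Q^Kerr| + |x|ⁿ⁺¹ |∂⁽ⁿ⁾ ∂_{C,J} k_Q^Kerr| ≤ C_D(n, γ) |x|⁻²`,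
for `|x| ≥ C_R(γ) (|M| + |M|⁻¹ |(C, J)|)`, where `M = sgn E √(E² − |P|²)` and `γ = |E| / |M|`."  (`Q^ADM` = the limits
`r → ∞` of the sphere charges, p. 4; `F^±` the even/odd parts; `∂_{E,P}`, `∂_{C,J}` the derivatives of the family in the
parameters `Q₀, …, Q₃`, resp. `Q₄, …, Q₉`.)
This rendering, on the component `E(Q) > |P(Q)|` of `𝓔` (so `M > 0`): ONE family `F : ℝ¹⁰ → (smooth data on ℝ³)` and
constant functions `C_R(γ)`, `C_D(n, γ)`, non-decreasing in `γ` (the reading used on p. 16, "`γ_max ≥ max{γ(Q), γ(Q')}`"),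
such that for each such `Q`, with `ρ = C_R(γ)(M + M⁻¹ |(C, J)|)`: beyond `ρ` the datum `F Q` is an exact spacelike leaf of
a Kerr–Schild chart `g_{M', a}` (`InitialDataSet.IsExactKerrEndAlong` with exceptional set `B̄_ρ`, chart the inclusion of
`{|x| > ρ}`; Kerr parameters existential) and solves the vacuum constraints there; its `η`-averaged charge vectors on
`A_r` tend to `Q` as `r → ∞` for every bump `η` ((4.3), averaged form); the family is jointly smooth in `(Q, x)` near
`{Q} × {|x| > ρ}` (the differentiability implicit in (4.6)–(4.8)); and (4.4)–(4.8) hold at every `x` with `|x| ≥ ρ`, the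
parameter derivatives being Fréchet derivatives in `Q` along the coordinate vectors `e₀, …, e₃` (`E, P`), `e₄, …, e₉`
(`C, J`).  The members are smooth data on all of `ℝ³` (only `{|x| > ρ}` is asserted to be Kerr: a convenience of this
rendering).  Named fact (D-0014).
-- TODO(general form): the component `E(Q) < −|P(Q)|` (negative `M`).
[cite: MaoOhTao2023, Lemma 4.2 (p. 15) and Appendix B] [cite: ChruscielDelay2003, §8 (the boosted Kerr family)] -/
def ExteriorKerrFamily : Prop :=
  ∀ [Kerr.Facts],
    ∃ (F : EuclideanSpace ℝ (Fin 10) → InitialDataSet (𝓡 3) E3) (CR : ℝ → ℝ) (CD : ℕ → ℝ → ℝ),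
      Monotone CR ∧ (∀ n, Monotone (CD n)) ∧
      ∀ Q : EuclideanSpace ℝ (Fin 10), momNorm Q < Q 0 →
        letI M : ℝ := massParam Q
        letI γ : ℝ := lorentzFactor Q
        letI ρ : ℝ := CR γ * (M + M⁻¹ * cjNorm Q)
        (∃ (M' a r₀ : ℝ) (hM' : 0 ≤ M') (ψ : exteriorRegion ρ → Kerr.region a r₀) (ν : NormalField 𝓘(ℝ, E4) ψ),
          (F Q).IsExactKerrEndAlong (Metric.closedBall 0 ρ) (exteriorRegion ρ) M' a r₀ hM' Subtype.val ψ ν) ∧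
        (∀ b : ℝ, (F Q).VacOn ρ b) ∧
        (∀ η : ℝ → ℝ, IsBump η →
          Tendsto (fun r : ℝ ↦ chargeVec η r (F Q).coordH (F Q).coordK) atTop (𝓝 Q)) ∧
        (∀ x : E3, ρ < ‖x‖ →
          ContDiffAt ℝ ∞ (fun p : EuclideanSpace ℝ (Fin 10) × E3 ↦ (F p.1).coordH p.2) (Q, x) ∧
          ContDiffAt ℝ ∞ (fun p : EuclideanSpace ℝ (Fin 10) × E3 ↦ (F p.1).coordK p.2) (Q, x)) ∧
        (∀ (n : ℕ) (x : E3), ρ ≤ ‖x‖ →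
          ‖x‖ ^ n * ‖iteratedFDeriv ℝ n (fun y ↦ (F Q).coordH y - (innerSL ℝ : E3 →L[ℝ] E3 →L[ℝ] ℝ)) x‖ +
              ‖x‖ ^ (n + 1) * ‖iteratedFDeriv ℝ n (F Q).coordK x‖ ≤ CD n γ * M * ‖x‖⁻¹ ∧
          ‖x‖ ^ n * ‖iteratedFDeriv ℝ n (oddPart (F Q).coordH) x‖ +
              ‖x‖ ^ (n + 1) * ‖iteratedFDeriv ℝ n (evenPart (F Q).coordK) x‖ ≤ CD n γ * M * ‖x‖⁻¹ ^ 2 ∧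
          (∀ i : Fin 10,
            letI dg : E3 → E3 →L[ℝ] E3 →L[ℝ] ℝ :=
              fun y ↦ fderiv ℝ (fun Q' ↦ (F Q').coordH y) Q (EuclideanSpace.single i 1)
            letI dk : E3 → E3 →L[ℝ] E3 →L[ℝ] ℝ :=
              fun y ↦ fderiv ℝ (fun Q' ↦ (F Q').coordK y) Q (EuclideanSpace.single i 1)
            ((i : ℕ) < 4 →
              ‖x‖ ^ n * ‖iteratedFDeriv ℝ n dg x‖ + ‖x‖ ^ (n + 1) * ‖iteratedFDeriv ℝ n dk x‖ ≤ CD n γ * ‖x‖⁻¹ ∧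
              ‖x‖ ^ n * ‖iteratedFDeriv ℝ n (oddPart dg) x‖ + ‖x‖ ^ (n + 1) * ‖iteratedFDeriv ℝ n (evenPart dk) x‖ ≤
                CD n γ * (M⁻¹ * cjNorm Q + 1) * ‖x‖⁻¹ ^ 2) ∧
            (4 ≤ (i : ℕ) →
              ‖x‖ ^ n * ‖iteratedFDeriv ℝ n dg x‖ + ‖x‖ ^ (n + 1) * ‖iteratedFDeriv ℝ n dk x‖ ≤
                CD n γ * ‖x‖⁻¹ ^ 2)))

end MaoOhTao

end Literature.Geometry.Lorentzian

end
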